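/-
Origin: expansion seat `planner-pub-hodgecm-mc-theta-3-g11-0`, handover (F1) 2026-08-20T02:50Z md5 b860d57f031debf1f8f42790888d204a (751 l.; NEW additive leaf; row-5 `A`-slot datum CONSTRUCTED: `archLineDatumOf … : ArchLineDatum V S hGR hGR₀ hGR₁ hGR₂ hGR₃ η μ` with Φinf/x₀/c built and hx₀/hctr₀…₃ PROVED; remaining hypotheses hpos₀…₃ (slot-side conditions) and hμ₀…₃ ((J-μ), E/binder-2); imports binder-2 #33 TorusLetters (RUN-39 row) and the twin (K39)) (`HOME/mc/pub-hodgecm-mc-theta-3-g11/lean/stage39/HodgeCM/Model/ArchLineDatumOf.lean`, md5 b860d57f031d, 751 lines);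
landed by the gen-14 packager (p-g14) in gate run 39 as `HodgeCM/Model/ArchLineDatumOf.lean` (verbatim).
-/
/-
Origin: CONSTRUCTION PROVER seat `planner-pub-hodgecm-mc-theta-3-g11-0` (unit pub-hodgecm-mc-theta-3-g11, theta supply / second-lift lane;
BINDER-OWNERS row 5 `A : ∀ k : Fin 4, ArchLineInput V (lineRepD V c.D … η k)`), RUN-39 draft v0 2026-08-20 (NEW additive leaf; imports the
frozen (E1) interface `Model/ArchLineInputOf` v0d 02321f8af1f9, carch-1 #CA13 `Model/ArchKTypeOfSlot` r2 274206a1dd08, `Model/ArchKTypeOfArch`,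
binder-2 #37 `HypCensus/TorusLetters` 392a86915ae1 (hence #33 `CompactLetters` 86d122dd0924), the K-1 twin
`Vendored/H21/NumberTheory/Automorphic/UnitaryGroupArchCenter` bdbcdc7a672a of tree p194977, and three vendored Segal–Bargmann leaves).
ABSOLUTE RULE: nothing below is a cited fact and nothing of PerL / QW8 / the 2001 programme is used; every statement is kernel-proved here from
the imports.  No proof holes; no notation commands (style lint L-notation).
-/
import Summits.HodgeConjecture.HodgeCM.Model.ArchLineInputOf
import Summits.HodgeConjecture.HodgeCM.Model.ArchKTypeOfSlot
import Summits.HodgeConjecture.HodgeCM.Model.ArchKTypeOfArch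
import Summits.HodgeConjecture.HodgeCM.Model.HypCensus.TorusLetters
import Literature.NumberTheory.Automorphic.UnitaryGroupArchCenter
import Literature.NumberTheory.NumberFields.NormOneTorusRealApproximation
import Literature.Analysis.SegalBargmann.SchwartzTensorSchur
import Literature.Analysis.SegalBargmann.SchwartzHeisenbergSchur
import Literature.Analysis.SegalBargmann.SchwartzIsotypicFockPolynomials

/-!
# The archimedean line datum of the S pin — CONSTRUCTED (`archLineDatumOf`)

The honest inhabitant of the frozen interface `ArchSideTerm.ArchLineDatum V S hGR hGR₀ hGR₁ hGR₂ hGR₃ η μ` ((E1), `Model/ArchLineInputOf`):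
per line `k : Fin 4` (the `W`-lines `⟨a₀⟩, ⟨a₁⟩` and the `W'`-lines `⟨a₂⟩, ⟨a₃⟩` of the seesaw datum `S`, each paired with `V = diag(frameD V)`)

* `Φinf k` — the archimedean test function, in carch-1's LITERAL SLOT spelling (#CA13 `blockFamilyOfAt`, `degOnePDual`):
  `Φ_∞,k := blockFamilyOfAt … (lineVec dₖ) … (blockPosEquiv V) (blockNegEquiv V) (posIdxEquivUnit hposₖ) (negIdxEquivEmpty hposₖ)
  (degOnePDual Empty) (binvPi 1) ⟨e₀, ·⟩` — the holomorphic degree-one vector `h_{e_{(0,⋆)}}` of the junction `U(2,1) × U(1)` at the place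
  `v₁` under `ι₁`, tensored with the vacuum at the other real places, pulled back through binder-2's block frame `cmBlockFrameAt v₁`
  (§ 3: it IS the Folland–Fock vector `follandFock cmBigFrame (∏_w P_w)` of an explicit place polynomial, `linePhi_eq_follandFock`);
* `x₀ k` — a rational base point with `Φ_∞,k(ι x₀) ≠ 0` (density of `ι (L⁺)³ ⊂ (L⁺ ⊗ ℝ)³`, § 0; no integrality is needed on the typed
  path — period-1-g10 01:49:16Z);
* `c k` — the eigenvalue of the archimedean centre `t · 1_V`, `t ∈ U(1)(L⁺ ⊗ ℝ)`, on `φ_N(Φ_∞,k)`: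
  `c k t = χₖ(t) · ι_{w(v₁)}(t)`, `χₖ` the vacuum character of the centre (binder-2's compact-letters engine at ALL places, § 2) and
  `ι_{w(v₁)}(t)` the degree-one weight at `v₁` (§ 4);
* (D5-ctr)ₖ `hctrₖ` — PROVED (§ 1 + § 4): `ω((t,1)·1_V, 1) φ_N(Φ_∞,k) = c k t • φ_N(Φ_∞,k)`, by the junction `(t · 1_V)_𝔸 = (t_∞ · 1_V, 1)`
  (tree p194977 `archToAdelic_cmArchCenter`), the pure-tensor form of the pair action at archimedean elements (#CA2
  `cmPairRep_archToAdelic_eq_adelicTensorEnd`) and the letter computation;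
* (J-μ)ₖ `hμₖ` — the weight identities stay the NAMED HYPOTHESES of the interface, now about the constructed `c k` (E / binder-2 discharge them
  from `lineCenterChar_spec` / `lineCenterChar_vacuum` below and the torus dictionaries).

Inputs that are genuine CONDITIONS on the pin (named, not facts): `hposₖ : 0 < cmXW … (lineVec dₖ) … (HypCensus.cmPlace ι₁) 0` — the line is on the
positive side of the canonical sign frame at `v₁` (this is exactly the existence of carch-1's slot bijections `eR : PosIdx ≃ Unit`,
`eS : NegIdx ≃ Empty`).  The sign facts of `V` (`frameD_sign_ι₁'`, `frameD_sign_of_ne`, unitary-1 `WmInstanceV2`) and of a line (§ 0) are theorems.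
-/

set_option autoImplicit false

noncomputable section

open NumberField NumberField.InfinitePlace NumberField.mixedEmbedding IsDedekindDomain
open scoped Matrix Kronecker Classical TensorProduct ComplexConjugate SchwartzMap
open MvPolynomial
open Literature.NumberTheory.Automorphic Literature.NumberTheory.Automorphic.UnitaryGroup Literature.NumberTheory.Weil1964
open Literature.RepresentationTheory.HeisenbergGroup (polar symplecticGroup)
open Literature.RepresentationTheory.KonnoKonno2007 Literature.RepresentationTheory.KonnoKonno2007.RealDualPair
open Literature.NumberTheory.GelbartRogawski1991 Literature.NumberTheory.GelbartRogawski1991.UnitaryDualPair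
open Literature.RepresentationTheory (atPlace)
open Literature.Analysis.SegalBargmann
open HodgeCM.Adelic HodgeCM.PerL34 HodgeCM.Model.HypCensus HodgeCM.Model.SupplyInstance

namespace HodgeCM.Model.ArchSideTerm

/-! ## § 0 Generic helpers: a positive line's blocks, test-function scalars, rational base points, line signs -/

section Generic

/-- for a line (`M = 1`) on the positive side of the sign frame: its positive block is a point … -/
def posIdxEquivUnit {x : Fin 1 → ℝ} (h : 0 < x 0) : PosIdx x ≃ Unit where
  toFun _ := ()
  invFun _ := ⟨0, h⟩
  left_inv _ := Subtype.ext (Subsingleton.elim _ _)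
  right_inv _ := rfl

/-- … and its non-positive block is empty. -/
def negIdxEquivEmpty {x : Fin 1 → ℝ} (h : 0 < x 0) : NegIdx x ≃ Empty where
  toFun i := False.elim (i.2 (by rw [Subsingleton.elim i.1 0]; exact h))
  invFun t := t.elim
  left_inv i := False.elim (i.2 (by rw [Subsingleton.elim i.1 0]; exact h))
  right_inv t := t.elim

/-- `φ_N(c • Φ_∞) = c • φ_N(Φ_∞)`. -/
theorem testFun_smul (K : Type) [Field K] [NumberField K] (J : Type) [Fintype J] (c : ℂ)
    (Φ : 𝓢((J → mixedSpace K), ℂ)) (x₀ : J → K) (N : ℕ) :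
    testFun K J (c • Φ) x₀ N = c • testFun K J Φ x₀ N :=
  Subtype.ext (thinCosetTestFun_smul c Φ _ _)

/-- `ι (K^J)` is dense in `(K ⊗ ℝ)^J`. [folklore: weak approximation at the infinite places] -/
theorem denseRange_archEmb (K : Type) [Field K] [NumberField K] (J : Type) : DenseRange (archEmb K J) := by
  have h : DenseRange (Pi.map fun _ : J => (mixedEmbedding K : K → mixedSpace K)) :=
    DenseRange.piMap fun _ => Literature.NumberTheory.NumberFields.denseRange_mixedEmbedding K
  exact h

/-- a nonzero archimedean Schwartz function does not vanish at some rational point. -/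
theorem exists_apply_archEmb_ne_zero (K : Type) [Field K] [NumberField K] (J : Type) [Fintype J]
    (Ψ : 𝓢((J → mixedSpace K), ℂ)) (hΨ : Ψ ≠ 0) : ∃ x₀ : J → K, Ψ (archEmb K J x₀) ≠ 0 := by
  by_contra h
  push Not at h
  refine hΨ (SchwartzMap.ext fun x => ?_)
  have hc : (Ψ : (J → mixedSpace K) → ℂ) = fun _ => 0 :=
    (denseRange_archEmb K J).equalizer Ψ.continuous continuous_const (funext h)
  exact congrFun hc x

variable (L : Type) [Field L] [NumberField L] [IsCMField L] (ι₁ : L →+* ℂ)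

/-- a real nonzero `d ∈ L` has `re ι₁(d) ≠ 0`, so the line `⟨d⟩` is definite at `ι₁` (the engine's `h₁W` for `M = 1`). -/
theorem lineVec_sign (d : L) (hd : IsCMField.complexConj L d = d) (hd0 : d ≠ 0) :
    (∀ j : Fin 1, 0 < (ι₁ (lineVec L d j)).re) ∨ ∀ j : Fin 1, (ι₁ (lineVec L d j)).re < 0 := by
  have him : (ι₁ d).im = 0 := by
    rw [← Complex.conj_eq_iff_im, ← IsCMField.complexEmbedding_complexConj L ι₁ d, hd]
  have hre : (ι₁ d).re ≠ 0 := fun h => (map_ne_zero ι₁).2 hd0 (Complex.ext h him)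
  rcases lt_or_gt_of_ne hre with h | h
  · exact Or.inr fun _ => h
  · exact Or.inl fun _ => h

omit [NumberField L] [IsCMField L] in
/-- a line has real rank `≤ 1` everywhere (the engine's `hW` for `M = 1`; no content). -/
theorem lineVec_sign_of_ne (d : L) (τ : L →+* ℂ) (_hτ : InfinitePlace.mk τ ≠ InfinitePlace.mk ι₁) :
    (∃ j₀ : Fin 1, ∀ j, j ≠ j₀ → 0 < (τ (lineVec L d j)).re) ∨ ∀ j, (τ (lineVec L d j)).re < 0 :=
  Or.inl ⟨0, fun j hj => absurd (Subsingleton.elim j 0) hj⟩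

end Generic

/-! ## § 1 The archimedean centre read back on thin-coset test functions ((J1)) -/

section ReadBack

variable (L : Type) [Field L] [NumberField L] [IsCMField L] {N M n : ℕ} (e : Fin N × Fin M ≃ Fin n)
variable (dV : Fin N → L) (hdV : ∀ i, IsCMField.complexConj L (dV i) = dV i) (hdV0 : ∀ i, dV i ≠ 0)
variable (dW : Fin M → L) (hdW : ∀ i, IsCMField.complexConj L (dW i) = dW i) (hdW0 : ∀ i, dW i ≠ 0)
variable (hGR : (cmSplittingDatum L e dV hdV hdV0 dW hdW hdW0).CompatibleSplitting)

/-- **`ω((t,1)·1_V, 1) = ω_∞(t_∞·1_V, 1) ⊗ 1`**: the pair action of the adelic central element of the norm-one idele `(t, 1)` is pure-tensor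
with archimedean factor binder-2's `cmArchWeilRep` at `(cmArchCenter t, 1)` (tree p194977 junction + #CA2). -/
theorem cmPairRep_cmCenter_inf_one_eq (t : ↥(Literature.NumberTheory.Automorphic.relNormOneInfUnits (↥(maximalRealSubfield L)) L)) :
    cmPairRep L e dV hdV hdV0 dW hdW hdW0 hGR
        (CMCenter L dV ((cmAdelicOneEquivRelNormOne L).symm (Literature.NumberTheory.Automorphic.relNormOneInfToIdeles (↥(maximalRealSubfield L)) L t)), 1) =
      adelicTensorEnd (cmArchWeilRep L e dV hdV hdV0 dW hdW hdW0 hGR (cmArchCenter L N (Matrix.diagonal dV) t, 1) :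
        𝓢((Fin n → mixedSpace (↥(maximalRealSubfield L))), ℂ) →ₗ[ℂ] _) LinearMap.id := by
  rw [← cmPairRep_archToAdelic_eq_adelicTensorEnd, map_one, archToAdelic_cmArchCenter]
  rfl

/-- … hence on thin-coset test functions: `ω((t,1)·1_V, 1) φ_N(Φ_∞) = φ_N(ω_∞(t_∞·1_V, 1) Φ_∞)` at every base point and level. -/
theorem cmPairRep_cmCenter_inf_one_testFun (t : ↥(Literature.NumberTheory.Automorphic.relNormOneInfUnits (↥(maximalRealSubfield L)) L))
    (Φ : 𝓢((Fin n → mixedSpace (↥(maximalRealSubfield L))), ℂ)) (x₀ : Fin n → ↥(maximalRealSubfield L)) (Nl : ℕ) :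
    cmPairRep L e dV hdV hdV0 dW hdW hdW0 hGR
        (CMCenter L dV ((cmAdelicOneEquivRelNormOne L).symm (Literature.NumberTheory.Automorphic.relNormOneInfToIdeles (↥(maximalRealSubfield L)) L t)), 1)
        (testFun (↥(maximalRealSubfield L)) (Fin n) Φ x₀ Nl) =
      testFun (↥(maximalRealSubfield L)) (Fin n)
        (cmArchWeilRep L e dV hdV hdV0 dW hdW hdW0 hGR (cmArchCenter L N (Matrix.diagonal dV) t, 1) Φ) x₀ Nl :=
  apply_testFun_of_eq_adelicTensorEnd (cmPairRep_cmCenter_inf_one_eq L e dV hdV hdV0 dW hdW hdW0 hGR t) Φ x₀ Nl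

end ReadBack

/-! ## § 2 The compact letters of the archimedean centre `t · 1_V` at every real place ((J2), engine = binder-2 #33) -/

section CenterLetters

variable (L : Type) [Field L] [NumberField L] [IsCMField L] {N M n : ℕ} (e : Fin N × Fin M ≃ Fin n)
variable (dV : Fin N → L) (hdV : ∀ i, IsCMField.complexConj L (dV i) = dV i) (hdV0 : ∀ i, dV i ≠ 0)
variable (dW : Fin M → L) (hdW : ∀ i, IsCMField.complexConj L (dW i) = dW i) (hdW0 : ∀ i, dW i ≠ 0)
variable (hGR : (cmSplittingDatum L e dV hdV hdV0 dW hdW hdW0).CompatibleSplitting) (ι₁ : L →+* ℂ)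

/-- the circle coordinates of `t · 1_V` at the complex place `w(v)` over `v`: the constant family `i ↦ ι_{w(v)}(t)`. -/
def centerPlaceCircles (v : {v : InfinitePlace ↥(maximalRealSubfield L) // v.IsReal}) :
    ↥(Literature.NumberTheory.Automorphic.relNormOneInfUnits (↥(maximalRealSubfield L)) L) →* (Fin N → Circle) :=
  MonoidHom.pi fun _ => NumberField.archPlaceChar L (cmPlaceOver L v).1

/-- (Ported verbatim from the HodgeCMPerL package; no docstring in the source.) -/
@[simp] theorem centerPlaceCircles_apply (v : {v : InfinitePlace ↥(maximalRealSubfield L) // v.IsReal})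
    (t : ↥(Literature.NumberTheory.Automorphic.relNormOneInfUnits (↥(maximalRealSubfield L)) L)) (i : Fin N) :
    centerPlaceCircles L (N := N) v t i = NumberField.archPlaceChar L (cmPlaceOver L v).1 t := rfl

/-- **the compact letter of `t · 1_V` at `v`**: `((diag_{P_v} c, diag_{Q_v} c), (1, 1))`, `c` the constant circle family, the `V`-blocks being
the sign blocks `P_v = PosIdx x_V`, `Q_v = NegIdx x_V` of the canonical frame. -/
def centerPlaceLetter (v : {v : InfinitePlace ↥(maximalRealSubfield L) // v.IsReal}) :
    ↥(Literature.NumberTheory.Automorphic.relNormOneInfUnits (↥(maximalRealSubfield L)) L) →*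
      DPK (PosIdx (cmXV L dV hdV ι₁ v)) (NegIdx (cmXV L dV hdV ι₁ v)) (PosIdx (cmXW L dV dW hdW ι₁ v))
        (NegIdx (cmXW L dV dW hdW ι₁ v)) :=
  (MonoidHom.inl (Matrix.unitaryGroup (PosIdx (cmXV L dV hdV ι₁ v)) ℂ × Matrix.unitaryGroup (NegIdx (cmXV L dV hdV ι₁ v)) ℂ)
      (Matrix.unitaryGroup (PosIdx (cmXW L dV dW hdW ι₁ v)) ℂ × Matrix.unitaryGroup (NegIdx (cmXW L dV dW hdW ι₁ v)) ℂ)).comp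
    (((diagHom.comp (circleRestrict fun i => 0 < cmXV L dV hdV ι₁ v i)).prod
        (diagHom.comp (circleRestrict fun i => ¬0 < cmXV L dV hdV ι₁ v i))).comp
      (centerPlaceCircles L v))

/-- (Ported verbatim from the HodgeCMPerL package; no docstring in the source.) -/
theorem centerPlaceLetter_fst (v : {v : InfinitePlace ↥(maximalRealSubfield L) // v.IsReal})
    (t : ↥(Literature.NumberTheory.Automorphic.relNormOneInfUnits (↥(maximalRealSubfield L)) L)) :
    (centerPlaceLetter L dV hdV dW hdW ι₁ v t).1 =
      (diagHom (circleRestrict (fun i => 0 < cmXV L dV hdV ι₁ v i) (centerPlaceCircles L v t)),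
        diagHom (circleRestrict (fun i => ¬0 < cmXV L dV hdV ι₁ v i) (centerPlaceCircles L v t))) := rfl

/-- (Ported verbatim from the HodgeCMPerL package; no docstring in the source.) -/
theorem centerPlaceLetter_snd (v : {v : InfinitePlace ↥(maximalRealSubfield L) // v.IsReal})
    (t : ↥(Literature.NumberTheory.Automorphic.relNormOneInfUnits (↥(maximalRealSubfield L)) L)) :
    (centerPlaceLetter L dV hdV dW hdW ι₁ v t).2 = 1 := rfl

/-- `t ↦ t · 1_N ∈ U(H)(L ⊗ ℝ)` is continuous. -/
theorem continuous_cmArchCenter (H : Matrix (Fin N) (Fin N) L) : Continuous (cmArchCenter L N H) := by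
  have hs : Continuous fun a : mixedSpace L => Matrix.diagonal fun _ : Fin N => a :=
    (continuous_pi fun _ => continuous_id).matrix_diagonal
  refine Continuous.subtype_mk ?_ _
  exact (Continuous.units_map (Matrix.scalar (Fin N) : mixedSpace L →+* Matrix (Fin N) (Fin N) (mixedSpace L)).toMonoidHom hs).comp
    ((Continuous.units_map _ (continuous_ringEquiv_mixedSpace L)).comp continuous_subtype_val)

/-- the local component of `t · 1_V` at the complex place `w(v)` is the scalar matrix `ι_{w(v)}(t) · 1`. -/
theorem coe_archAt_cmArchCenter (v : {v : InfinitePlace ↥(maximalRealSubfield L) // v.IsReal})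
    (t : ↥(Literature.NumberTheory.Automorphic.relNormOneInfUnits (↥(maximalRealSubfield L)) L)) :
    (((archAt (↥(maximalRealSubfield L)) L (IsCMField.complexConj L) N (Matrix.diagonal dV) (cmPlaceOver L v)
        (cmPlaceOver_smul L v) (IsCMField.complexConj_ne_one L) (cmArchCenter L N (Matrix.diagonal dV) t) :
          archLocal L N (Matrix.diagonal dV) (cmPlaceOver L v)) : GL (Fin N) ℂ) : Matrix (Fin N) (Fin N) ℂ) =
      Matrix.diagonal fun i => ((centerPlaceCircles L (N := N) v t i : Circle) : ℂ) := by
  ext i j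
  rw [coe_archAt_apply, cmArchCenter_eq, coe_archCenter, Matrix.smul_apply, Matrix.one_apply, Matrix.diagonal_apply]
  split_ifs with h
  · rw [smul_eq_mul, mul_one]; rfl
  · rw [smul_zero]; rfl

/-- the `V`-component of a place component (definitional; binder-2's `fst_cmPlaceComponent` for general `M`). -/
theorem fst_cmPlaceComponent_eq (v : {v : InfinitePlace ↥(maximalRealSubfield L) // v.IsReal})
    (x : UnitaryGroup.arch (↥(maximalRealSubfield L)) L (IsCMField.complexConj L) N (Matrix.diagonal dV))
    (y : UnitaryGroup.arch (↥(maximalRealSubfield L)) L (IsCMField.complexConj L) M (Matrix.diagonal dW)) :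
    (cmPlaceComponent L dV hdV hdV0 dW hdW hdW0 ι₁ v (x, y)).1 =
      archUForm L (IsCMField.complexConj L) N (IsCMField.complexConj_ne_one L) (cmPlaceOver L) (cmPlaceOver_smul L)
        (cmPlaceOver_comap L) (cmRealVec L dV hdV) (realDiagonal_map L dV hdV).symm v (cmEpsV L dV hdV ι₁ v)
        (cmDV_ne_zero L dV hdV hdV0 ι₁ v) (cmSignConv_ne_zero L dV ι₁ v) (cm_htV L dV hdV hdV0 ι₁ v)
        (archToAdelic (↥(maximalRealSubfield L)) L (IsCMField.complexConj L) N (Matrix.diagonal dV) x) := rfl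

/-- the `W`-component of a place component (definitional). -/
theorem snd_cmPlaceComponent_eq (v : {v : InfinitePlace ↥(maximalRealSubfield L) // v.IsReal})
    (x : UnitaryGroup.arch (↥(maximalRealSubfield L)) L (IsCMField.complexConj L) N (Matrix.diagonal dV))
    (y : UnitaryGroup.arch (↥(maximalRealSubfield L)) L (IsCMField.complexConj L) M (Matrix.diagonal dW)) :
    (cmPlaceComponent L dV hdV hdV0 dW hdW hdW0 ι₁ v (x, y)).2 =
      archUForm L (IsCMField.complexConj L) M (IsCMField.complexConj_ne_one L) (cmPlaceOver L) (cmPlaceOver_smul L)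
        (cmPlaceOver_comap L) (cmRealVec L dW hdW) (realDiagonal_map L dW hdW).symm v (cmEpsW L dV dW hdW ι₁ v)
        (cmDW_ne_zero L dV dW hdW hdW0 ι₁ v) (cmCW_ne_zero L dV ι₁ v) (cm_htW L dV dW hdW hdW0 ι₁ v)
        (archToAdelic (↥(maximalRealSubfield L)) L (IsCMField.complexConj L) M (Matrix.diagonal dW) y) := rfl

/-- **the place components of `(t · 1_V, 1)` are the centre letters**: `cmPlaceComponent v (t·1_V, 1) = κ (centerPlaceLetter v t)`. -/
theorem cmPlaceComponent_center (v : {v : InfinitePlace ↥(maximalRealSubfield L) // v.IsReal})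
    (t : ↥(Literature.NumberTheory.Automorphic.relNormOneInfUnits (↥(maximalRealSubfield L)) L)) :
    cmPlaceComponent L dV hdV hdV0 dW hdW hdW0 ι₁ v (cmArchCenter L N (Matrix.diagonal dV) t, 1) =
      κ _ _ _ _ (centerPlaceLetter L dV hdV dW hdW ι₁ v t) := by
  refine Prod.ext ?_ ?_
  · -- the `V`-component: the scalar `ι_{w(v)}(t) · 1`, frame-conjugated and sign-sorted
    rw [fst_cmPlaceComponent_eq]
    apply Subtype.ext
    apply Units.ext
    rw [coe_archUForm, archPart_archToAdelic, coe_archAt_cmArchCenter, scaleConj_diagonal _ (cmDV_ne_zero L dV hdV hdV0 ι₁ v)]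
    exact (coe_kV_diagHom_restrict (fun i => 0 < cmXV L dV hdV ι₁ v i) (centerPlaceCircles L v t)).symm
  · -- the `W`-component: `1` on both sides
    rw [snd_cmPlaceComponent_eq, map_one]
    refine (map_one _).trans ?_
    change (1 : UForm _ _) = UForm.kV _ _ (centerPlaceLetter L dV hdV dW hdW ι₁ v t).2
    rw [centerPlaceLetter_snd, map_one]

/-- **the centre in the archimedean pair group**: `t ↦ (t · 1_V, 1)`. -/
def centerPairHom :
    ↥(Literature.NumberTheory.Automorphic.relNormOneInfUnits (↥(maximalRealSubfield L)) L) →*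
      UnitaryGroup.arch (↥(maximalRealSubfield L)) L (IsCMField.complexConj L) N (Matrix.diagonal dV) ×
        UnitaryGroup.arch (↥(maximalRealSubfield L)) L (IsCMField.complexConj L) M (Matrix.diagonal dW) :=
  (cmArchCenter L N (Matrix.diagonal dV)).prod 1

/-- (Ported verbatim from the HodgeCMPerL package; no docstring in the source.) -/
@[simp] theorem centerPairHom_apply (t : ↥(Literature.NumberTheory.Automorphic.relNormOneInfUnits (↥(maximalRealSubfield L)) L)) :
    centerPairHom L (M := M) dV dW t = (cmArchCenter L N (Matrix.diagonal dV) t, 1) := rfl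

/-- (Ported verbatim from the HodgeCMPerL package; no docstring in the source.) -/
theorem continuous_centerPairHom : Continuous (centerPairHom L (M := M) dV dW) :=
  (continuous_cmArchCenter L (Matrix.diagonal dV)).prodMk continuous_const

/-- **ONE CHARACTER FOR THE CENTRE.**  Under the sign facts of the pin there is ONE continuous character `χ : U(1)(L⁺ ⊗ ℝ) →* S¹` with
`ω_∞(t·1_V, 1) (follandFock 𝔢 G) = χ t • follandFock 𝔢 (G ∘ (centre letter block)⁻¹)` for every Fock polynomial `G` of the big frame.
[Folland1989, Prop. (4.39); Weil1964, Chap. I n° 12] -/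
theorem exists_character_cmArchWeilRep_center
    (h₁V : ∃ i₀ : Fin N, (∀ i, i ≠ i₀ → 0 < (ι₁ (dV i)).re) ∨ ∀ i, i ≠ i₀ → (ι₁ (dV i)).re < 0)
    (h₁W : (∀ j, 0 < (ι₁ (dW j)).re) ∨ ∀ j, (ι₁ (dW j)).re < 0)
    (hV : ∀ τ : L →+* ℂ, InfinitePlace.mk τ ≠ InfinitePlace.mk ι₁ →
      (∀ i, 0 < (τ (dV i)).re) ∨ ∀ i, (τ (dV i)).re < 0)
    (hW : ∀ τ : L →+* ℂ, InfinitePlace.mk τ ≠ InfinitePlace.mk ι₁ →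
      (∃ j₀ : Fin M, ∀ j, j ≠ j₀ → 0 < (τ (dW j)).re) ∨ ∀ j, (τ (dW j)).re < 0) :
    ∃ χ : ↥(Literature.NumberTheory.Automorphic.relNormOneInfUnits (↥(maximalRealSubfield L)) L) →* Circle, Continuous χ ∧
      ∀ (t : ↥(Literature.NumberTheory.Automorphic.relNormOneInfUnits (↥(maximalRealSubfield L)) L))
        (G : MvPolynomial (Fin n × {v : InfinitePlace ↥(maximalRealSubfield L) // v.IsReal}) ℂ),
        cmArchWeilRep L e dV hdV hdV0 dW hdW hdW0 hGR (cmArchCenter L N (Matrix.diagonal dV) t, 1)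
            (follandFock (cmBigFrame L e dV hdV hdV0 dW hdW hdW0 ι₁) G) =
          ((χ t : Circle) : ℂ) •
            follandFock (cmBigFrame L e dV hdV hdV0 dW hdW hdW0 ι₁)
              (linSubst (star ((cmLetterBlock L e dV hdV dW hdW ι₁ (centerPlaceLetter L dV hdV dW hdW ι₁) t :
                Matrix.unitaryGroup (Fin n × {v : InfinitePlace ↥(maximalRealSubfield L) // v.IsReal}) ℂ) :
                  Matrix _ _ ℂ)) G) :=
  exists_character_cmArchWeilRep_follandFock L e dV hdV hdV0 dW hdW hdW0 hGR ι₁ h₁V h₁W hV hW (centerPairHom L dV dW)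
    (continuous_centerPairHom L dV dW) (centerPlaceLetter L dV hdV dW hdW ι₁)
    (fun v t => cmPlaceComponent_center L dV hdV hdV0 dW hdW hdW0 ι₁ v t)

end CenterLetters

/-! ## § 3 The line's place polynomial and its Folland–Fock vector (the slot spelling unfolded) -/

section LinePoly

/-- `rename` on the degree-one Fock basis. -/
theorem rename_zeta_single {σ τ : Type} [Fintype σ] [Fintype τ] (f : σ → τ) (i : σ) :
    rename f (zeta (Finsupp.single i 1)) = zeta (Finsupp.single (f i) 1) := by
  rw [zeta_single, zeta_single, map_smul, rename_X]

/-- the diagonal substitution on the degree-one Fock basis: `ζ_{eᵢ} ∘ diag(d)ᴴ = d̄ᵢ ζ_{eᵢ}`. -/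
theorem linSubst_star_diagonal_zeta_single {σ : Type} [Fintype σ] [DecidableEq σ] (d : σ → ℂ) (i : σ) :
    linSubst (star (Matrix.diagonal d)) (zeta (Finsupp.single i 1)) = star (d i) • zeta (Finsupp.single i 1) := by
  rw [Matrix.star_eq_conjTranspose, Matrix.diagonal_conjTranspose, linSubst_zeta_single,
    Finset.sum_eq_single i (fun j _ hj => by rw [Matrix.diagonal_apply_ne _ (Ne.symm hj), zero_smul])
      (fun h => (h (Finset.mem_univ i)).elim), Matrix.diagonal_apply_eq]
  rfl

variable (S' : Type) [Fintype S'] [DecidableEq S']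

omit [DecidableEq S'] in
/-- **the degree-one Fock polynomial** `Σ_p b_p ζ_{e_{(p,⋆)}}` of the junction `U(2,1) × U(1,|S'|)` (variables of the `V⁺ ⊗ W⁺` block). -/
def degOnePoly (b : Fin 2 → ℂ) : MvPolynomial (DPIdx (Fin 2) Unit Unit S') ℂ :=
  ∑ pr : Fin 2 × Unit, b pr.1 • zeta (Finsupp.single (Sum.inl (Sum.inl pr) : DPIdx (Fin 2) Unit Unit S') 1)

/-- carch-1's literal family is its Bargmann image: `degOneP b = B⁻¹ (degOnePoly b)`. -/
theorem degOneP_eq_binvPi_degOnePoly (b : Fin 2 → ℂ) :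
    (degOneP b : SchwartzMap (DPIdx (Fin 2) Unit Unit S' → ℝ) ℂ) = binvPi (degOnePoly S' b) := by
  rw [degOneP_apply, degOnePR_apply, degOne_apply, degOnePoly]
  change _ = binvPiₗ _
  rw [map_sum]
  simp only [map_smul, binvPiₗ_apply, binvPi_zeta, Fintype.sum_sum_type, Sum.elim_inl, Sum.elim_inr, Pi.zero_apply, zero_smul,
    Finset.sum_const_zero, add_zero, curryUnit_apply]

omit [DecidableEq S'] in
/-- a diagonal substitution whose conjugate entries are one constant `a` on the `V⁺ ⊗ W⁺` block scales the (relabelled) degree-one polynomial by `a`. -/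
theorem linSubst_star_diagonal_rename_degOnePoly {n : ℕ} (d : Fin n → ℂ) (ε : Fin n ≃ DPIdx (Fin 2) Unit Unit S') (a : ℂ)
    (hd : ∀ pr : Fin 2 × Unit, star (d (ε.symm (Sum.inl (Sum.inl pr)))) = a) (b : Fin 2 → ℂ) :
    linSubst (star (Matrix.diagonal d)) (rename ε.symm (degOnePoly S' b)) = a • rename ε.symm (degOnePoly S' b) := by
  simp only [degOnePoly, map_sum, map_smul, rename_zeta_single, linSubst_star_diagonal_zeta_single, hd, Finset.smul_sum,
    smul_smul, mul_comm a]

/-- the literal family is nonzero at `e₀`: `degOneP e₀ ≠ 0`. -/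
theorem degOneP_single_ne_zero :
    (degOneP (Pi.single 0 1 : Fin 2 → ℂ) : SchwartzMap (DPIdx (Fin 2) Unit Unit S' → ℝ) ℂ) ≠ 0 := fun h => by
  have h1 := degOneP_injective (h.trans (map_zero (degOneP (P := Fin 2) (Q := Unit) (S := S'))).symm)
  have h2 := congrFun h1 0
  simp only [Pi.single_eq_same, Pi.zero_apply] at h2
  exact one_ne_zero h2

/-- the vacuum `B⁻¹ 1` is nonzero. -/
theorem binvPi_one_ne_zero {σ : Type} [Fintype σ] : (binvPi (1 : MvPolynomial σ ℂ) : SchwartzMap (σ → ℝ) ℂ) ≠ 0 := fun h => by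
  have h0 : (binvPi (0 : MvPolynomial σ ℂ) : SchwartzMap (σ → ℝ) ℂ) = 0 := by rw [← binvPiₗ_apply, map_zero]
  exact one_ne_zero (binvPi_injective (h.trans h0.symm))

variable (L : Type) [Field L] [NumberField L] [IsCMField L] {N M n : ℕ} (e : Fin N × Fin M ≃ Fin n)
variable (dV : Fin N → L) (hdV : ∀ i, IsCMField.complexConj L (dV i) = dV i) (hdV0 : ∀ i, dV i ≠ 0)
variable (dW : Fin M → L) (hdW : ∀ i, IsCMField.complexConj L (dW i) = dW i) (hdW0 : ∀ i, dW i ≠ 0)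
variable (hGR : (cmSplittingDatum L e dV hdV hdV0 dW hdW hdW0).CompatibleSplitting) (ι₁ : L →+* ℂ)
variable (eP : PosIdx (cmXV L dV hdV ι₁ (HypCensus.cmPlace L ι₁)) ≃ Fin 2) (eQ : NegIdx (cmXV L dV hdV ι₁ (HypCensus.cmPlace L ι₁)) ≃ Unit)
  (eR : PosIdx (cmXW L dV dW hdW ι₁ (HypCensus.cmPlace L ι₁)) ≃ Unit) (eS : NegIdx (cmXW L dV dW hdW ι₁ (HypCensus.cmPlace L ι₁)) ≃ S')

/-- **the place polynomials of the line**: the degree-one polynomial at `v₁` (pulled back to the pin's coordinates along `cmPlaceIdxAt v₁`),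
the constant `1` (vacuum) at every other real place. -/
def linePlacePoly (b : Fin 2 → ℂ) : {v : InfinitePlace ↥(maximalRealSubfield L) // v.IsReal} → MvPolynomial (Fin n) ℂ :=
  Function.update (fun _ => 1) (HypCensus.cmPlace L ι₁)
    (rename (cmPlaceIdxAt L e dV hdV dW hdW ι₁ (HypCensus.cmPlace L ι₁) eP eQ eR eS).symm (degOnePoly S' b))

omit [DecidableEq S'] in
/-- (Ported verbatim from the HodgeCMPerL package; no docstring in the source.) -/
theorem linePlacePoly_same (b : Fin 2 → ℂ) :
    linePlacePoly S' L e dV hdV dW hdW ι₁ eP eQ eR eS b (HypCensus.cmPlace L ι₁) =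
      rename (cmPlaceIdxAt L e dV hdV dW hdW ι₁ (HypCensus.cmPlace L ι₁) eP eQ eR eS).symm (degOnePoly S' b) :=
  Function.update_self _ _ _

omit [DecidableEq S'] in
/-- (Ported verbatim from the HodgeCMPerL package; no docstring in the source.) -/
theorem linePlacePoly_of_ne (b : Fin 2 → ℂ) {w : {v : InfinitePlace ↥(maximalRealSubfield L) // v.IsReal}} (hw : w ≠ HypCensus.cmPlace L ι₁) :
    linePlacePoly S' L e dV hdV dW hdW ι₁ eP eQ eR eS b w = 1 :=
  Function.update_of_ne hw _ _

omit [DecidableEq S'] in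
/-- the place product of the line is its `v₁`-factor. -/
theorem prod_linePlacePoly (b : Fin 2 → ℂ) :
    ∏ w, rename (atPlace w) (linePlacePoly S' L e dV hdV dW hdW ι₁ eP eQ eR eS b w) =
      rename (atPlace (HypCensus.cmPlace L ι₁))
        (rename (cmPlaceIdxAt L e dV hdV dW hdW ι₁ (HypCensus.cmPlace L ι₁) eP eQ eR eS).symm (degOnePoly S' b)) := by
  rw [Finset.prod_eq_single (HypCensus.cmPlace L ι₁) (fun w _ hw => by rw [linePlacePoly_of_ne S' L e dV hdV dW hdW ι₁ eP eQ eR eS b hw, map_one])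
    (fun h => (h (Finset.mem_univ _)).elim), linePlacePoly_same]


-- port_pkg: scope closed for this part
end LinePoly
end HodgeCM.Model.ArchSideTerm
end
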